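import Summits.CriticalPhenomena.Ising3DConformalLimit.Theorems.RotationJoining.Negative.LayeredMeasure
import Literature.Probability.LatticeModels.CriticalGibbsUniqueness
import Literature.Probability.LatticeModels.PlusMinusStateGibbs

/-!
# `RotationJoining` (crux stmt-CriticalPhenomena-18763, route `SynchronousCoupling`):
# the DLR hypothesis `μ ∈ 𝒢(β_c)` is load-bearing — for translation-invariant probability
# measures the statement is FALSE (negative-side support, refuter cdisprove seat, cycle 1)

`RotationJoining` claims: for every `μ ∈ 𝒢(β_c)` (n.n. Ising on `ℤ³`, `h = 0`) that is translation
invariant, `∃ C θ > 0 ∀ n ≥ 1 ∀ m ∃ π ∈ Couplings(μ, μ) ∀ |u_i| ≤ m`, the `L²(π)`-distance between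
the self-normalised spin sum of copy 1 over the rotated cell `T⁻¹(n(u+[0,1)³))` (`T = A/3`,
`A = ((2,2,−1),(−1,2,2),(2,−1,2))`) and the self-normalised spin sum of copy 2 over the axis cell
`n(u+[0,1)³)` is `≤ C n^(−θ)` (read-back: `rotationJoining_iff` in `Negative/Defs.lean`).

Here we record, sorry-free:

* `rotationJoining_iff_withoutTI` — the translation-invariance hypothesis is DECORATIVE: `𝒢(β_c)`
  is a singleton in `d = 3` (`hasUniqueGibbsMeasure_criticalBeta_holds`) whose element is the
  translation-invariant plus state (`exists_plusMeasure_holds`).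
* `rotationJoining_false_without_gibbs` — the DLR hypothesis is LOAD-BEARING:
  `¬ ∀ μ, IsProbabilityMeasure μ → IsTranslationInvariantMeasure μ → (body of the crux)`.
  Witness `μL` = horizontally layered i.i.d. fair spins (`σ_x = ε_{x₂}`, `Negative/Defs.lean`).
  Mechanism (`defect_pair_lower_bound`): under ANY coupling of `μL` with itself the axis blocks
  `u = 0` and `u = e₀` of copy 2 are literally equal, while at `n = 3k` the rotated blocks `0` and
  `e₀` of copy 1 are lattice translates (`rotCell_e0_eq_map`, the Σ3 commensurability) whose layer
  profiles are shifts of each other by `k` out of a support of length `< 5k`, hence differ in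
  `L²(μL)` by at least `1/25` of the normalisation (telescoping inequality
  `sum_sq_le_sq_mul_sum_sq_sub_shift`); so `max(defect₀, defect_{e₀}) ≥ 1/150` at every scale
  `n = 3k`, against `C n^(−θ) → 0`.

Moral for provers: any proof of `RotationJoining` must feed in (asymptotic, quantitative)
ISOTROPY of the block-spin law of `μ_c` — an exact degeneracy of the axis block field that the
rotated block field does not share kills every coupling. This file does NOT refute the crux.
-/

namespace Summit.CriticalPhenomena.Ising3DConformalLimit.Theorems.RotationJoining.Negative

open MeasureTheory Filter Finset
open Literature.Probability.LatticeModels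
open Summit.CriticalPhenomena.Ising3DConformalLimit.Theses.SynchronousCoupling

noncomputable section

/-! ## Decorative hypothesis: translation invariance -/

/-- Translation invariance is decorative: at `β_c` in `d = 3` the Gibbs measure is unique
(`hasUniqueGibbsMeasure_criticalBeta_holds`, ADS 2015) and the plus state is translation invariant
(`exists_plusMeasure_holds`), so the crux is a statement about ONE measure and the hypothesis
`IsTranslationInvariantMeasure μ` can be dropped. -/
theorem rotationJoining_iff_withoutTI :
    RotationJoining ↔ ∀ μ ∈ isingGibbsMeasures 3 (criticalBeta 3) 0, ∃ C θ : ℝ, 0 < θ ∧ ∀ n m : ℕ, 1 ≤ n →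
      ∃ π : Measure (SpinConfig (Site 3) × SpinConfig (Site 3)), π.fst = μ ∧ π.snd = μ ∧
        ∀ u : Fin 3 → ℤ, (∀ i, |u i| ≤ m) → defect μ n m u π ≤ C * (n : ℝ) ^ (-θ) := by
  rw [rotationJoining_iff]
  refine ⟨fun h μ hμ => ?_, fun h μ hμ _ => h μ hμ⟩
  obtain ⟨hsub, -⟩ := hasUniqueGibbsMeasure_criticalBeta_holds (d := 3) (by norm_num)
  obtain ⟨μ', hμ', hTI, -⟩ :=
    exists_plusMeasure_holds (d := 3) (β := criticalBeta 3) (h := 0) (criticalBeta_nonneg 3)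
  have hμμ' : μ = μ' := hsub hμ hμ'
  exact h μ hμ (hμμ' ▸ hTI)

/-! ## No coupling of `μL` with itself has a small rotation defect at two adjacent blocks -/

/-- Integration against `μL` is integration of the layered function against `P`. -/
theorem integral_μL {f : SpinConfig (Site 3) → ℝ} (hf : Measurable f) :
    ∫ σ, f σ ∂μL = ∫ ε, f (layer ε) ∂P := by
  unfold μL
  exact integral_map measurable_layer.aemeasurable hf.aestronglyMeasurable

/-- `|c · Σ_{x∈s} σ_x| ≤ |c| #s`. -/
theorem abs_const_mul_blockSum_le (c : ℝ) (s : Finset (Site 3)) (σ : SpinConfig (Site 3)) :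
    |c * blockSum s σ| ≤ |c| * s.card := by
  have h := norm_blockSum_le s σ
  rw [Real.norm_eq_abs] at h
  rw [abs_mul]
  exact mul_le_mul_of_nonneg_left h (abs_nonneg c)

/-- `Fk` is measurable. -/
@[fun_prop] theorem measurable_Fk (k : ℕ) : Measurable (Fk k) := by unfold Fk; fun_prop

/-- `Gk` is measurable. -/
@[fun_prop] theorem measurable_Gk (k : ℕ) : Measurable (Gk k) := by unfold Gk; fun_prop

/-- `Hk` is measurable. -/
@[fun_prop] theorem measurable_Hk (k : ℕ) : Measurable (Hk k) := by unfold Hk; fun_prop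

/-- `Kk` is measurable. -/
@[fun_prop] theorem measurable_Kk (k : ℕ) : Measurable (Kk k) := by unfold Kk; fun_prop

/-- `Fk` is bounded. -/
theorem abs_Fk_le (k : ℕ) (q : SpinConfig (Site 3) × SpinConfig (Site 3)) :
    |Fk k q| ≤ |normaliser μL (rotCell₀ (3 * k) 1)| * (rotCell₀ (3 * k) 1).card :=
  abs_const_mul_blockSum_le _ _ _

/-- `Gk` is bounded. -/
theorem abs_Gk_le (k : ℕ) (q : SpinConfig (Site 3) × SpinConfig (Site 3)) :
    |Gk k q| ≤ |normaliser μL (rotCell₀ (3 * k) 1)| * (rotCell (3 * k) 1 (Pi.single 0 1)).card :=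
  abs_const_mul_blockSum_le _ _ _

/-- `Hk` is bounded. -/
theorem abs_Hk_le (k : ℕ) (q : SpinConfig (Site 3) × SpinConfig (Site 3)) :
    |Hk k q| ≤ |normaliser μL (axisCell₀ (3 * k))| * (axisCell₀ (3 * k)).card :=
  abs_const_mul_blockSum_le _ _ _

/-- `Kk` is bounded. -/
theorem abs_Kk_le (k : ℕ) (q : SpinConfig (Site 3) × SpinConfig (Site 3)) :
    |Kk k q| ≤ |normaliser μL (axisCell₀ (3 * k))| * (axisCell (3 * k) (Pi.single 0 1)).card :=
  abs_const_mul_blockSum_le _ _ _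

/-- The crux's defect at `u = 0` in terms of `Fk`, `Hk`. -/
theorem defect_zero_eq (k : ℕ) (π : Measure (SpinConfig (Site 3) × SpinConfig (Site 3))) :
    defect μL (3 * k) 1 0 π = ∫ q, (Fk k q - Hk k q) ^ 2 ∂π := by
  unfold defect Fk Hk
  rw [rotCell_zero, axisCell_zero]

/-- The crux's defect at `u = e₀` in terms of `Gk`, `Kk`. -/
theorem defect_e0_eq (k : ℕ) (π : Measure (SpinConfig (Site 3) × SpinConfig (Site 3))) :
    defect μL (3 * k) 1 (Pi.single 0 1) π = ∫ q, (Kk k q - Gk k q) ^ 2 ∂π := by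
  unfold defect Gk Kk
  congr 1; funext q; ring

/-- Under any coupling with second marginal `μL`, the two axis blocks of copy 2 coincide. -/
theorem integral_HK_sq (k : ℕ) (π : Measure (SpinConfig (Site 3) × SpinConfig (Site 3)))
    (hsnd : π.snd = μL) : ∫ q, (Hk k q - Kk k q) ^ 2 ∂π = 0 := by
  have hmeas : Measurable (fun σ : SpinConfig (Site 3) =>
      (normaliser μL (axisCell₀ (3 * k)) * blockSum (axisCell₀ (3 * k)) σ -
        normaliser μL (axisCell₀ (3 * k)) * blockSum (axisCell (3 * k) (Pi.single 0 1)) σ) ^ 2) := by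
    fun_prop
  have h1 : ∫ q, (Hk k q - Kk k q) ^ 2 ∂π =
      ∫ σ, (normaliser μL (axisCell₀ (3 * k)) * blockSum (axisCell₀ (3 * k)) σ -
        normaliser μL (axisCell₀ (3 * k)) * blockSum (axisCell (3 * k) (Pi.single 0 1)) σ) ^ 2
        ∂(π.map Prod.snd) :=
    (integral_map measurable_snd.aemeasurable hmeas.aestronglyMeasurable).symm
  have hsnd' : π.map Prod.snd = μL := hsnd
  rw [h1, hsnd', integral_μL (by fun_prop)]
  simp [blockSum_axisCell_e0_layer]

/-- Under any coupling with first marginal `μL`, the two rotated blocks of copy 1 differ by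
`α² · V₁(k)` in `L²`. -/
theorem integral_FG_sq (k : ℕ) (π : Measure (SpinConfig (Site 3) × SpinConfig (Site 3)))
    (hfst : π.fst = μL) :
    ∫ q, (Fk k q - Gk k q) ^ 2 ∂π = (normaliser μL (rotCell₀ (3 * k) 1)) ^ 2 * V1 k := by
  have hmeas : Measurable (fun σ : SpinConfig (Site 3) =>
      (normaliser μL (rotCell₀ (3 * k) 1) * blockSum (rotCell₀ (3 * k) 1) σ -
        normaliser μL (rotCell₀ (3 * k) 1) * blockSum (rotCell (3 * k) 1 (Pi.single 0 1)) σ) ^ 2) := by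
    fun_prop
  have h1 : ∫ q, (Fk k q - Gk k q) ^ 2 ∂π =
      ∫ σ, (normaliser μL (rotCell₀ (3 * k) 1) * blockSum (rotCell₀ (3 * k) 1) σ -
        normaliser μL (rotCell₀ (3 * k) 1) * blockSum (rotCell (3 * k) 1 (Pi.single 0 1)) σ) ^ 2
        ∂(π.map Prod.fst) :=
    (integral_map measurable_fst.aemeasurable hmeas.aestronglyMeasurable).symm
  have hfst' : π.map Prod.fst = μL := hfst
  rw [h1, hfst', integral_μL (by fun_prop)]
  have h2 : ∀ ε, (normaliser μL (rotCell₀ (3 * k) 1) * blockSum (rotCell₀ (3 * k) 1) (layer ε) -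
      normaliser μL (rotCell₀ (3 * k) 1) * blockSum (rotCell (3 * k) 1 (Pi.single 0 1)) (layer ε)) ^ 2 =
      (normaliser μL (rotCell₀ (3 * k) 1)) ^ 2 *
        (blockSum (rotCell₀ (3 * k) 1) (layer ε) -
          blockSum (rotCell (3 * k) 1 (Pi.single 0 1)) (layer ε)) ^ 2 :=
    fun ε => by ring
  simp_rw [h2]
  rw [integral_const_mul, integral_sq_blockSum_sub]

/-- The self-normalisation of copy 1 read through `μL`: `α² = 1 / V₀(k)`. -/
theorem normaliser_rotCell₀_sq (k : ℕ) : (normaliser μL (rotCell₀ (3 * k) 1)) ^ 2 = (V0 k)⁻¹ := by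
  unfold normaliser
  rw [integral_μL (by fun_prop), integral_sq_blockSum_rotCell₀, inv_pow, Real.sq_sqrt (V0_nonneg k)]

/-- KEY ESTIMATE. For every coupling `π` of `μL` with itself and every `B` bounding the crux's
defect at the two blocks `u = 0` and `u = e₀` (scale `n = 3k`, window `m = 1`): `1/25 ≤ 6B`. -/
theorem defect_pair_lower_bound {k : ℕ} (hk : 1 ≤ k)
    (π : Measure (SpinConfig (Site 3) × SpinConfig (Site 3))) (hfst : π.fst = μL) (hsnd : π.snd = μL)
    {B : ℝ} (hD0 : defect μL (3 * k) 1 0 π ≤ B) (hD1 : defect μL (3 * k) 1 (Pi.single 0 1) π ≤ B) :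
    (1:ℝ) / 25 ≤ 6 * B := by
  haveI : IsProbabilityMeasure π := ⟨by rw [← Measure.fst_univ, hfst]; exact measure_univ⟩
  rw [defect_zero_eq] at hD0
  rw [defect_e0_eq] at hD1
  -- squares of differences of bounded measurable functions are integrable on the coupled space
  have hsq : ∀ {f g : SpinConfig (Site 3) × SpinConfig (Site 3) → ℝ}, Measurable f → Measurable g →
      ∀ {Bf Bg : ℝ}, (∀ x, |f x| ≤ Bf) → (∀ x, |g x| ≤ Bg) →
      Integrable (fun x => (f x - g x) ^ 2) π := by
    intro f g hf hg Bf Bg hBf hBg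
    refine Integrable.of_bound ((hf.sub hg).pow_const 2).aestronglyMeasurable ((Bf + Bg) ^ 2)
      (ae_of_all _ (fun x => ?_))
    rw [Real.norm_eq_abs, abs_pow]
    have h1 : |f x - g x| ≤ Bf + Bg := (abs_sub _ _).trans (add_le_add (hBf x) (hBg x))
    exact pow_le_pow_left₀ (abs_nonneg _) h1 2
  have hI1 : Integrable (fun q => (Fk k q - Hk k q) ^ 2) π :=
    hsq (measurable_Fk k) (measurable_Hk k) (abs_Fk_le k) (abs_Hk_le k)
  have hI2 : Integrable (fun q => (Hk k q - Kk k q) ^ 2) π :=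
    hsq (measurable_Hk k) (measurable_Kk k) (abs_Hk_le k) (abs_Kk_le k)
  have hI3 : Integrable (fun q => (Kk k q - Gk k q) ^ 2) π :=
    hsq (measurable_Kk k) (measurable_Gk k) (abs_Kk_le k) (abs_Gk_le k)
  have hI0 : Integrable (fun q => (Fk k q - Gk k q) ^ 2) π :=
    hsq (measurable_Fk k) (measurable_Gk k) (abs_Fk_le k) (abs_Gk_le k)
  have hpt : ∀ q, (Fk k q - Gk k q) ^ 2 ≤
      3 * ((Fk k q - Hk k q) ^ 2 + (Hk k q - Kk k q) ^ 2 + (Kk k q - Gk k q) ^ 2) := by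
    intro q
    nlinarith [sq_nonneg (Fk k q - Hk k q - (Hk k q - Kk k q)),
      sq_nonneg (Hk k q - Kk k q - (Kk k q - Gk k q)), sq_nonneg (Fk k q - Hk k q - (Kk k q - Gk k q))]
  have hle : ∫ q, (Fk k q - Gk k q) ^ 2 ∂π ≤
      3 * (∫ q, (Fk k q - Hk k q) ^ 2 ∂π + ∫ q, (Hk k q - Kk k q) ^ 2 ∂π +
        ∫ q, (Kk k q - Gk k q) ^ 2 ∂π) := by
    calc ∫ q, (Fk k q - Gk k q) ^ 2 ∂π
        ≤ ∫ q, 3 * ((Fk k q - Hk k q) ^ 2 + (Hk k q - Kk k q) ^ 2 + (Kk k q - Gk k q) ^ 2) ∂π :=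
          integral_mono hI0 (((hI1.add hI2).add hI3).const_mul 3) hpt
      _ = 3 * (∫ q, (Fk k q - Hk k q) ^ 2 ∂π + ∫ q, (Hk k q - Kk k q) ^ 2 ∂π +
            ∫ q, (Kk k q - Gk k q) ^ 2 ∂π) := by
          have hI12 : Integrable (fun q => (Fk k q - Hk k q) ^ 2 + (Hk k q - Kk k q) ^ 2) π :=
            hI1.add hI2
          rw [integral_const_mul, integral_add hI12 hI3, integral_add hI1 hI2]
  rw [integral_HK_sq k π hsnd, integral_FG_sq k π hfst, normaliser_rotCell₀_sq] at hle
  have hV0 : 1 ≤ V0 k := one_le_V0 hk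
  have hV1 : V0 k ≤ 25 * V1 k := V0_le k
  have hpos : 0 < V0 k := by linarith
  have hkey : (1:ℝ) / 25 ≤ (V0 k)⁻¹ * V1 k := by
    rw [inv_mul_eq_div, le_div_iff₀ hpos]
    linarith
  linarith

/-- `μL` admits NO power-rate rotation joining: the body of the crux fails for `μ = μL`. -/
theorem not_RJBody_μL : ¬ ∃ C θ : ℝ, 0 < θ ∧ ∀ n m : ℕ, 1 ≤ n →
      ∃ π : Measure (SpinConfig (Site 3) × SpinConfig (Site 3)), π.fst = μL ∧ π.snd = μL ∧
        ∀ u : Fin 3 → ℤ, (∀ i, |u i| ≤ m) → defect μL n m u π ≤ C * (n : ℝ) ^ (-θ) := by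
  rintro ⟨C, θ, hθ, H⟩
  have key : ∀ k : ℕ, 1 ≤ k → (1:ℝ) / 25 ≤ 6 * (C * (((3 * k : ℕ) : ℝ)) ^ (-θ)) := by
    intro k hk
    obtain ⟨π, hfst, hsnd, Hu⟩ := H (3 * k) 1 (by omega)
    exact defect_pair_lower_bound hk π hfst hsnd (Hu 0 (fun i => by simp))
      (Hu (Pi.single 0 1) abs_single_le)
  have h3' : Tendsto (fun k : ℕ => 3 * k) atTop atTop :=
    tendsto_atTop_atTop.2 (fun b => ⟨b, fun a ha => by omega⟩)
  have h3 : Tendsto (fun k : ℕ => ((3 * k : ℕ) : ℝ)) atTop atTop :=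
    tendsto_natCast_atTop_atTop.comp h3'
  have hlim : Tendsto (fun k : ℕ => 6 * (C * (((3 * k : ℕ) : ℝ)) ^ (-θ))) atTop
      (nhds (6 * (C * 0))) :=
    (((tendsto_rpow_neg_atTop hθ).comp h3).const_mul C).const_mul 6
  rw [mul_zero, mul_zero] at hlim
  have hev : ∀ᶠ k : ℕ in atTop, 6 * (C * (((3 * k : ℕ) : ℝ)) ^ (-θ)) ∈ Set.Iio ((1:ℝ) / 25) :=
    hlim.eventually_mem (Iio_mem_nhds (by norm_num))
  obtain ⟨k, hk1, hk2⟩ := (hev.and (eventually_ge_atTop 1)).exists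
  exact absurd (key k hk2) (not_le.2 hk1)

/-! ## The load-bearing analysis, stated against the crux -/

/-- LOAD-BEARING: the crux with its DLR/criticality hypothesis `μ ∈ 𝒢(β_c)` weakened to
"`μ` is a probability measure" (Gibbs measures are probability measures,
`IsGibbsMeasure.isProbabilityMeasure`, so this weakening of the hypothesis strengthens the
statement) is FALSE: the translation-invariant layered i.i.d. measure `μL` has no power-rate
(indeed no `o(1)`) rotation joining. Any proof of `RotationJoining` must use `μ ∈ 𝒢(β_c)`. -/
theorem rotationJoining_false_without_gibbs :
    ¬ ∀ μ : Measure (SpinConfig (Site 3)), IsProbabilityMeasure μ →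
        IsTranslationInvariantMeasure μ → ∃ C θ : ℝ, 0 < θ ∧ ∀ n m : ℕ, 1 ≤ n →
      ∃ π : Measure (SpinConfig (Site 3) × SpinConfig (Site 3)), π.fst = μ ∧ π.snd = μ ∧
        ∀ u : Fin 3 → ℤ, (∀ i, |u i| ≤ m) → defect μ n m u π ≤ C * (n : ℝ) ^ (-θ) :=
  fun h => not_RJBody_μL (h μL inferInstance isTranslationInvariant_μL)

end

end Summit.CriticalPhenomena.Ising3DConformalLimit.Theorems.RotationJoining.Negative
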